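import Mathlib.LinearAlgebra.Matrix.NonsingularInverse
import Literature.InformationTheory.QuantumCodes.AbelianTwoBlockParameters
import Literature.InformationTheory.QuantumCodes.CSSParameters
import HarnessLib

/-!
# A common invertible factor does not change an abelian two-block code: `GB(fa, fb) = GB(a, b)`

Source: R. Wang, L. P. Pryadko, *Distance bounds for generalized bicycle codes*, Symmetry **14** (2022)
1348 = arXiv:2203.17216 [WangPryadko2022]; held text `paper:arxiv-2203.17216` (arXiv TeX, chunks
pNNNN). §3.1 Statement 3 [chunk p0006 L115-141] lists polynomial transformations generating EQUIVALENT
generalized-bicycle codes `GB(a, b)` (`H_X = [A|B]`, `H_Z = [Bᵀ|Aᵀ]`, `A, B` circulant); its fifth item is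
"`a'(x) = f(x) a(x)`, `b'(x) = f(x) b(x)`, for some polynomial `f(x) ∈ 𝔽_q[x]` such that
`gcd(f, x^ℓ − 1) = 1`" [p0006 L131-132], with the remark "the last one may be useful for constructing
LDPC codes, since minimum row weight does not necessarily correspond to minimum polynomial degrees"
[p0006 L134-137]. (Items (i)–(iv) — `x ↦ x^m`, block swap, reciprocals, scalars — are the census
symmetries already in the tree: `TwoBlockCodeEquivalences.lean`, `TwoBlockGAEquivalenceClasses.lean`,
Lin–Pryadko Thm 6.)

What is proved here, for EVERY finite abelian group `G` (the printed case is `G = ℤ_ℓ`, where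
`gcd(f, x^ℓ − 1) = 1` says exactly that `f` is invertible in `𝔽₂[x]/(x^ℓ − 1)`, i.e. that the circulant
matrix `F = circulant f` is invertible) and over `𝔽₂` (the tree's `CSSCode` is binary):

* `AbelianTwoBlock.HX_conv`, `AbelianTwoBlock.HZ_conv` — with `f ⋆ a := circulant f *ᵥ a` (the
  group-algebra product: `circulant (f ⋆ a) = circulant f * circulant a`, Mathlib `circulant_mul`),
  `H_X(f⋆a, f⋆b) = F · H_X(a,b)` and `H_Z(f⋆a, f⋆b) = Fᵀ · H_Z(a,b)` — LEFT multiplications (all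
  `G`-circulants commute); PROVED, no invertibility needed.
* `pcCode_mul_of_isUnit`, `rowSpace_mul_of_isUnit` — an invertible left factor changes neither the
  code `ker H` nor the row space `rs H` of a parity-check matrix; PROVED (Mathlib's
  `mulVec_injective_iff_isUnit` / `vecMul_surjective_iff_isUnit`).
* `CSSCode.dX_eq_of_codes_eq`, `dZ_eq_of_codes_eq`, `k_eq_of_codes_eq`, `isCode_iff_of_codes_eq` —
  two CSS codes on the same qubits with the same four classical codes `ker H_X, ker H_Z, rs H_X, rs H_Z`
  have the same `d^X, d^Z, k` and the same `[[n,k,d]]` predicate; PROVED (definitional bookkeeping).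
* `AbelianTwoBlock.css_conv_rowSpX_eq` / `…_rowSpZ_eq` / `…_kerX_eq` / `…_kerZ_eq` and
  `css_conv_dX`, `css_conv_dZ`, `css_conv_k`, `css_conv_isCode_iff` — **Statement 3(v)**: for `F`
  invertible, `css (f⋆a) (f⋆b)` and `css a b` have the SAME `X`- and `Z`-stabilizer spaces (they are
  the same stabilizer code, not merely permutation-equivalent) and hence the same parameters; PROVED.

* `AbelianTwoBlock.isUnit_circulant_of_conv_eq_single`, `css_conv_isCode_iff_of_inverse` — the
  invertibility hypothesis from an explicit inverse `f ⋆ g = δ₀` (certificate form); and, for the printed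
  cyclic case `G = ℤ_ℓ` (`Fin ℓ`), `isUnit_circulant_of_isCoprime` / `isUnit_circulant_of_gcd_eq_one`
  (Bézout identity evaluated at the cyclic shift `P`, `P^ℓ = 1`, `f(P) = circulant f`) and
  `css_conv_isCode_iff_of_gcd_eq_one` / `…_of_isCoprime` — **Statement 3(v) with its hypothesis exactly as
  printed**, `gcd(f, x^ℓ − 1) = 1` (`gbPoly f`, Euclidean `gcd` in `𝔽₂[x]`); PROVED.

Not here: the converse direction / non-invertible `f` (then `[FA|FB]` generates a subcode); the
`q`-ary case of the code statement (the invertibility lemmas are over any field); items (i)–(iv)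
(already in the tree).
-/

namespace Literature.InformationTheory.QuantumCodes

open Matrix

/-! ### An invertible left factor preserves `ker H` and `rs H` -/

section LeftFactor

variable {R Q : Type*} [Fintype R] [Fintype Q] [DecidableEq R]

/-- `ker (M H) = ker H` for an invertible square `M` (left row operations do not change the code with
parity-check matrix `H`). Proved. [cite: WangPryadko2022, §3.1 Statement 3 (arXiv:2203.17216 chunk p0006 L131-137)] -/
theorem pcCode_mul_of_isUnit {M : Matrix R R (ZMod 2)} (hM : IsUnit M) (H : Matrix R Q (ZMod 2)) :
    pcCode (M * H) = pcCode H := by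
  ext x
  rw [mem_pcCode_iff, mem_pcCode_iff, ← mulVec_mulVec]
  constructor
  · intro h
    exact (mulVec_injective_iff_isUnit.2 hM) (by rw [h, mulVec_zero])
  · intro h
    rw [h, mulVec_zero]

omit [Fintype Q] in
/-- `rs (M H) = rs H` for an invertible square `M`. Proved.
[cite: WangPryadko2022, §3.1 Statement 3 (arXiv:2203.17216 chunk p0006 L131-137)] -/
theorem rowSpace_mul_of_isUnit {M : Matrix R R (ZMod 2)} (hM : IsUnit M) (H : Matrix R Q (ZMod 2)) :
    rowSpace (M * H) = rowSpace H := by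
  ext x
  rw [mem_rowSpace_iff, mem_rowSpace_iff]
  constructor
  · rintro ⟨y, rfl⟩
    exact ⟨y ᵥ* M, by rw [vecMul_vecMul]⟩
  · rintro ⟨y, rfl⟩
    obtain ⟨y', hy'⟩ := (vecMul_surjective_iff_isUnit.2 hM) y
    refine ⟨y', ?_⟩
    have hy'' : y' ᵥ* M = y := hy'
    rw [← vecMul_vecMul, hy'']

end LeftFactor

/-! ### CSS bookkeeping: same four classical codes ⇒ same parameters -/

namespace CSSCode

variable {RX RZ RX' RZ' Q : Type*} [Fintype Q]
variable [Fintype RX] [Fintype RZ] [Fintype RX'] [Fintype RZ']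
variable {C : CSSCode RX RZ Q} {C' : CSSCode RX' RZ' Q}

omit [Fintype RZ] [Fintype RZ'] in
/-- Same `ker H_Z` and `rs H_X` ⇒ same `d^X`. Proved (definitional).
[cite: BravyiEtAl2024, §4, proof of Lemma 1 ("d^X = min{|v| : v ∈ ker H^Z ∖ rs H^X}")] -/
theorem dX_eq_of_codes_eq (hZ : pcCode C'.HZ = pcCode C.HZ) (hX : rowSpace C'.HX = rowSpace C.HX) :
    C'.dX = C.dX := by
  show sInf (hammingNorm '' ((pcCode C'.HZ : Set (Q → ZMod 2)) \ rowSpace C'.HX)) =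
    sInf (hammingNorm '' ((pcCode C.HZ : Set (Q → ZMod 2)) \ rowSpace C.HX))
  rw [hZ, hX]

omit [Fintype RX] [Fintype RX'] in
/-- Same `ker H_X` and `rs H_Z` ⇒ same `d^Z`. Proved (definitional).
[cite: BravyiEtAl2024, §4, proof of Lemma 1 ("d^Z = min{|v| : v ∈ ker H^X ∖ rs H^Z}")] -/
theorem dZ_eq_of_codes_eq (hX : pcCode C'.HX = pcCode C.HX) (hZ : rowSpace C'.HZ = rowSpace C.HZ) :
    C'.dZ = C.dZ := by
  rw [dZ_eq, dZ_eq]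
  show sInf (hammingNorm '' ((pcCode C'.HX : Set (Q → ZMod 2)) \ rowSpace C'.HZ)) =
    sInf (hammingNorm '' ((pcCode C.HX : Set (Q → ZMod 2)) \ rowSpace C.HZ))
  rw [hX, hZ]

omit [Fintype RZ] [Fintype RZ'] in
/-- Same `ker H_Z` and `rs H_X` ⇒ same `k`. Proved (definitional).
[cite: NielsenChuang2010, §10.4.2 p. 450 ("CSS(C₁,C₂) is an [n, k₁ − k₂] quantum code")] -/
theorem k_eq_of_codes_eq (hZ : pcCode C'.HZ = pcCode C.HZ) (hX : rowSpace C'.HX = rowSpace C.HX) :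
    C'.k = C.k := by
  show Module.finrank (ZMod 2) (pcCode C'.HZ) - Module.finrank (ZMod 2) (rowSpace C'.HX) =
    Module.finrank (ZMod 2) (pcCode C.HZ) - Module.finrank (ZMod 2) (rowSpace C.HX)
  rw [hZ, hX]

/-- Same four classical codes (`ker H_X`, `ker H_Z`, `rs H_X`, `rs H_Z`) on the same qubits ⇒ the same
`[[n, k, d]]` predicate. Proved (definitional: `cssMinDist` and `k` only see these four codes).
[cite: TillichZemor2014, §2 (arXiv v1 chunk p0004 L9-18: the CSS minimum distance in terms of C_X, C_Z, C_X^⊥, C_Z^⊥)] -/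
theorem isCode_iff_of_codes_eq (hX : pcCode C'.HX = pcCode C.HX) (hZ : pcCode C'.HZ = pcCode C.HZ)
    (hrX : rowSpace C'.HX = rowSpace C.HX) (hrZ : rowSpace C'.HZ = rowSpace C.HZ) (n k d : ℕ) :
    C'.IsCode n k d ↔ C.IsCode n k d := by
  unfold IsCode
  rw [k_eq_of_codes_eq hZ hrX]
  have hmin : cssMinDist C'.HX C'.HZ = cssMinDist C.HX C.HZ := by
    unfold cssMinDist
    rw [hX, hZ, hrX, hrZ]
  rw [hmin]

end CSSCode

/-! ### Statement 3(v): a common invertible factor -/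

namespace AbelianTwoBlock

variable {G : Type*} [Fintype G] [AddCommGroup G]

section Matrices

variable {R : Type*} [CommRing R]

/-- `H_X(f⋆a, f⋆b) = F · H_X(a, b)` with `F = circulant f`, `f ⋆ a = F a` (so `circulant (f ⋆ a) = F A`).
Proved. [cite: WangPryadko2022, §3.1 Statement 3 (arXiv:2203.17216 chunk p0006 L115-137)] -/
theorem HX_conv (f a b : G → R) :
    HX (circulant f *ᵥ a) (circulant f *ᵥ b) = circulant f * HX a b := by
  rw [HX_def, HX_def, mul_fromCols, circulant_mul, circulant_mul]

/-- `H_Z(f⋆a, f⋆b) = Fᵀ · H_Z(a, b)`: `(F B)ᵀ = Bᵀ Fᵀ = Fᵀ Bᵀ` because `G`-circulants commute.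
Proved. [cite: WangPryadko2022, §3.1 Statement 3 (arXiv:2203.17216 chunk p0006 L115-137)] -/
theorem HZ_conv (f a b : G → R) :
    HZ (circulant f *ᵥ a) (circulant f *ᵥ b) = (circulant f)ᵀ * HZ a b := by
  rw [HZ_def, HZ_def, mul_fromCols, ← circulant_mul, ← circulant_mul, circulant_mul_comm f b,
    circulant_mul_comm f a, transpose_mul, transpose_mul]

end Matrices

variable [DecidableEq G]

/-- Same `X`-stabilizer space: `rs H_X(f⋆a, f⋆b) = rs H_X(a,b)` for `F = circulant f` invertible.
Proved. [cite: WangPryadko2022, §3.1 Statement 3(v) (arXiv:2203.17216 chunk p0006 L131-132)] -/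
theorem css_conv_rowSpX_eq {f : G → ZMod 2} (hf : IsUnit (circulant f)) (a b : G → ZMod 2) :
    rowSpace (css (circulant f *ᵥ a) (circulant f *ᵥ b)).HX = rowSpace (css a b).HX := by
  rw [css_HX, css_HX, HX_conv, rowSpace_mul_of_isUnit hf]

/-- Same `Z`-stabilizer space: `rs H_Z(f⋆a, f⋆b) = rs H_Z(a,b)` for `F` invertible. Proved.
[cite: WangPryadko2022, §3.1 Statement 3(v) (arXiv:2203.17216 chunk p0006 L131-132)] -/
theorem css_conv_rowSpZ_eq {f : G → ZMod 2} (hf : IsUnit (circulant f)) (a b : G → ZMod 2) :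
    rowSpace (css (circulant f *ᵥ a) (circulant f *ᵥ b)).HZ = rowSpace (css a b).HZ := by
  rw [css_HZ, css_HZ, HZ_conv, rowSpace_mul_of_isUnit ((isUnit_transpose _).2 hf)]

/-- Same `ker H_X`. Proved. [cite: WangPryadko2022, §3.1 Statement 3(v) (arXiv:2203.17216 chunk p0006 L131-132)] -/
theorem css_conv_kerX_eq {f : G → ZMod 2} (hf : IsUnit (circulant f)) (a b : G → ZMod 2) :
    pcCode (css (circulant f *ᵥ a) (circulant f *ᵥ b)).HX = pcCode (css a b).HX := by
  rw [css_HX, css_HX, HX_conv, pcCode_mul_of_isUnit hf]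

/-- Same `ker H_Z`. Proved. [cite: WangPryadko2022, §3.1 Statement 3(v) (arXiv:2203.17216 chunk p0006 L131-132)] -/
theorem css_conv_kerZ_eq {f : G → ZMod 2} (hf : IsUnit (circulant f)) (a b : G → ZMod 2) :
    pcCode (css (circulant f *ᵥ a) (circulant f *ᵥ b)).HZ = pcCode (css a b).HZ := by
  rw [css_HZ, css_HZ, HZ_conv, pcCode_mul_of_isUnit ((isUnit_transpose _).2 hf)]

/-- **Statement 3(v), `X`-distance**: `d^X(GB(fa, fb)) = d^X(GB(a, b))` for `f` invertible in the group
algebra (`gcd(f, x^ℓ − 1) = 1` in the cyclic case). Proved.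
[cite: WangPryadko2022, §3.1 Statement 3(v) (arXiv:2203.17216 chunk p0006 L115-132)] -/
theorem css_conv_dX {f : G → ZMod 2} (hf : IsUnit (circulant f)) (a b : G → ZMod 2) :
    (css (circulant f *ᵥ a) (circulant f *ᵥ b)).dX = (css a b).dX :=
  CSSCode.dX_eq_of_codes_eq (css_conv_kerZ_eq hf a b) (css_conv_rowSpX_eq hf a b)

/-- **Statement 3(v), `Z`-distance**: `d^Z(GB(fa, fb)) = d^Z(GB(a, b))`. Proved.
[cite: WangPryadko2022, §3.1 Statement 3(v) (arXiv:2203.17216 chunk p0006 L115-132)] -/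
theorem css_conv_dZ {f : G → ZMod 2} (hf : IsUnit (circulant f)) (a b : G → ZMod 2) :
    (css (circulant f *ᵥ a) (circulant f *ᵥ b)).dZ = (css a b).dZ :=
  CSSCode.dZ_eq_of_codes_eq (css_conv_kerX_eq hf a b) (css_conv_rowSpZ_eq hf a b)

/-- **Statement 3(v), dimension**: `k(GB(fa, fb)) = k(GB(a, b))`. Proved.
[cite: WangPryadko2022, §3.1 Statement 3(v) (arXiv:2203.17216 chunk p0006 L115-132)] -/
theorem css_conv_k {f : G → ZMod 2} (hf : IsUnit (circulant f)) (a b : G → ZMod 2) :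
    (css (circulant f *ᵥ a) (circulant f *ᵥ b)).k = (css a b).k :=
  CSSCode.k_eq_of_codes_eq (css_conv_kerZ_eq hf a b) (css_conv_rowSpX_eq hf a b)

/-- **Statement 3(v), parameters**: `GB(fa, fb)` is `[[n, k, d]]` iff `GB(a, b)` is, for `f` invertible
(indeed the two are the same stabilizer code: same `rs H_X`, same `rs H_Z`). Proved.
[cite: WangPryadko2022, §3.1 Statement 3(v) (arXiv:2203.17216 chunk p0006 L115-132)] -/
theorem css_conv_isCode_iff {f : G → ZMod 2} (hf : IsUnit (circulant f)) (a b : G → ZMod 2)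
    (n k d : ℕ) :
    (css (circulant f *ᵥ a) (circulant f *ᵥ b)).IsCode n k d ↔ (css a b).IsCode n k d :=
  CSSCode.isCode_iff_of_codes_eq (css_conv_kerX_eq hf a b) (css_conv_kerZ_eq hf a b)
    (css_conv_rowSpX_eq hf a b) (css_conv_rowSpZ_eq hf a b) n k d

end AbelianTwoBlock


/-! ### Discharging the invertibility hypothesis by an explicit inverse (appended 2026-08-27, qec-lit-3 g3) -/

namespace AbelianTwoBlock

variable {G : Type*} [Fintype G] [AddCommGroup G] [DecidableEq G]

/-- A CERTIFICATE form of the hypothesis `gcd(f, x^ℓ − 1) = 1`: if `f ⋆ g = δ₀` for some `g` (an explicit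
inverse in the group algebra — for the cyclic case the Bézout cofactor of `f` modulo `x^ℓ − 1`), then
`F = circulant f` is invertible, so all `css_conv_*` statements apply. The premise is a finite identity a
kernel `decide` can check on concrete data. Proved.
[cite: WangPryadko2022, §3.1 Statement 3(v) (arXiv:2203.17216 chunk p0006 L131-132)] -/
theorem isUnit_circulant_of_conv_eq_single {R : Type*} [CommRing R] (f g : G → R)
    (h : circulant f *ᵥ g = Pi.single 0 1) : IsUnit (circulant f) := by
  have h1 : circulant f * circulant g = 1 := by
    rw [circulant_mul, h, circulant_single_one]
  exact ⟨⟨circulant f, circulant g, h1, mul_eq_one_comm.1 h1⟩, rfl⟩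

/-- Same `[[n,k,d]]` predicate for `GB(fa, fb)` and `GB(a, b)` given an explicit inverse `g` of `f`
(`f ⋆ g = δ₀`). Proved. [cite: WangPryadko2022, §3.1 Statement 3(v) (arXiv:2203.17216 chunk p0006 L115-132)] -/
theorem css_conv_isCode_iff_of_inverse (f g : G → ZMod 2) (h : circulant f *ᵥ g = Pi.single 0 1)
    (a b : G → ZMod 2) (n k d : ℕ) :
    (css (circulant f *ᵥ a) (circulant f *ᵥ b)).IsCode n k d ↔ (css a b).IsCode n k d :=
  css_conv_isCode_iff (isUnit_circulant_of_conv_eq_single f g h) a b n k d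

end AbelianTwoBlock

/-! ### The printed hypothesis `gcd(f, x^ℓ − 1) = 1` (appended 2026-08-27, qec-lit-3 g3)

For the printed cyclic case `G = ℤ_ℓ` (indices `Fin ℓ`, the vocabulary of `PanteleevKalachev2021_prop1`:
`gbPoly f = GBDim.vecPoly f = Σ_i f_i xⁱ`), the hypothesis of Statement 3(v) is discharged from its printed
form: a Bézout identity `u f + v (x^ℓ − 1) = 1` evaluated at the cyclic shift `P = circulant δ₁` (`P^ℓ = 1`,
`f(P) = circulant f`) gives `u(P) · circulant f = 1`. No quotient ring is needed. -/

section PrintedHypothesis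

open Polynomial

namespace AbelianTwoBlock

section CyclicShift

variable {F : Type*} [CommRing F] {ℓ : ℕ}

/-- `circulant` commutes with finite sums. [folklore] -/
private theorem circulant_finset_sum {ι : Type*} (s : Finset ι) (g : ι → Fin ℓ → F) :
    circulant (∑ i ∈ s, g i) = ∑ i ∈ s, circulant (g i) := by
  ext x y
  simp [circulant_apply, Matrix.sum_apply, Finset.sum_apply]

variable [NeZero ℓ]

/-- Shifting a delta: `circulant δ_i · δ_j = δ_{i+j}` (indices `ℤ_ℓ = Fin ℓ`). [folklore] -/
private theorem circulant_single_mulVec_single (i j : Fin ℓ) (c : F) :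
    circulant (Pi.single i (1 : F)) *ᵥ Pi.single j c = Pi.single (i + j) c := by
  ext x
  simp only [mulVec, dotProduct, circulant_apply, Pi.single_apply, mul_ite, mul_zero,
    Finset.sum_ite_eq', Finset.mem_univ, if_true]
  by_cases hx : x = i + j
  · subst hx; simp
  · have : ¬ (x - j = i) := by intro h; apply hx; rw [← h, sub_add_cancel]
    simp [hx, this]

/-- Powers of the cyclic shift `P = circulant δ₁`: `P^n = circulant δ_{n mod ℓ}`. [folklore] -/
private theorem circulant_single_one_pow (n : ℕ) :
    (circulant (Pi.single (1 : Fin ℓ) (1 : F))) ^ n =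
      circulant (Pi.single (Fin.ofNat ℓ n) (1 : F)) := by
  induction n with
  | zero =>
    rw [pow_zero, show Fin.ofNat ℓ 0 = 0 from Fin.ext (by simp), circulant_single_one]
  | succ n ih =>
    rw [pow_succ, ih, circulant_mul, circulant_single_mulVec_single]
    congr 2
    ext
    simp [Fin.val_add, Nat.add_mod]

/-- `P^ℓ = 1` for the cyclic shift `P = circulant δ₁` on `F^ℓ`. [folklore] -/
private theorem circulant_single_one_pow_card :
    (circulant (Pi.single (1 : Fin ℓ) (1 : F))) ^ ℓ = 1 := by
  rw [circulant_single_one_pow, show Fin.ofNat ℓ ℓ = 0 from Fin.ext (by simp), circulant_single_one]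

end CyclicShift

section Coprime

variable {F : Type*} [Field F] {ℓ : ℕ} [NeZero ℓ]

/-- "Given a polynomial `a(x) ∈ 𝓡`, the corresponding circulant matrix `A` [first column
`(a₀, a₁, …)`, i.e. `A_{ij} = a_{i−j}` = Mathlib's `circulant a`] is conveniently written as the polynomial
`A ≡ a(P)` of the matrix `P ≡ P_n`, the `n × n` cyclic permutation matrix" [`P_{ij} = 1 ⇔ i = j + 1`, i.e.
`P = circulant δ₁`]: evaluating `f(x) = Σ_i f_i xⁱ` (`GBDim.vecPoly f`) at `P` gives `circulant f`. Proved.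
[cite: WangPryadko2022, §2 eqs. for `A` and `P`, "A ≡ a(P)" (arXiv:2203.17216 chunk p0005 L30-56)] -/
theorem aeval_circulant_single_vecPoly (f : Fin ℓ → F) :
    aeval (circulant (Pi.single (1 : Fin ℓ) (1 : F))) (GBDim.vecPoly f) = circulant f := by
  unfold GBDim.vecPoly
  rw [map_sum]
  simp only [aeval_monomial, circulant_single_one_pow, Fin.ofNat_val_eq_self]
  calc ∑ i : Fin ℓ, (algebraMap F (Matrix (Fin ℓ) (Fin ℓ) F)) (f i) * circulant (Pi.single i 1)
      = ∑ i : Fin ℓ, circulant (Pi.single i (f i)) := by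
        refine Finset.sum_congr rfl fun i _ => ?_
        rw [Algebra.algebraMap_eq_smul_one, smul_mul_assoc, one_mul, ← circulant_smul]
        congr 1
        ext x
        simp [Pi.single_apply]
    _ = circulant (∑ i : Fin ℓ, Pi.single i (f i)) := (circulant_finset_sum _ _).symm
    _ = circulant f := by rw [Finset.univ_sum_single]

/-- **Printed hypothesis form of Statement 3(v).** If `gcd(f, x^ℓ − 1) = 1` — typed as
`IsCoprime f(x) (x^ℓ − 1)` in `F[x]` — then the circulant matrix `circulant f` is invertible: evaluate
a Bézout identity `u·f + v·(x^ℓ − 1) = 1` at the cyclic shift `P` (`P^ℓ = 1`, `f(P) = circulant f`).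
Proved. [cite: WangPryadko2022, §3.1 Statement 3(v) (arXiv:2203.17216 chunk p0006 L131-132)] -/
theorem isUnit_circulant_of_isCoprime (f : Fin ℓ → F)
    (h : IsCoprime (GBDim.vecPoly f) ((X : F[X]) ^ ℓ - 1)) : IsUnit (circulant f) := by
  obtain ⟨u, v, huv⟩ := h
  have key := congrArg (aeval (circulant (Pi.single (1 : Fin ℓ) (1 : F)))) huv
  rw [map_add, map_mul, map_mul, map_one, aeval_circulant_single_vecPoly, map_sub, map_pow, aeval_X,
    map_one, circulant_single_one_pow_card, sub_self, mul_zero, add_zero] at key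
  exact ⟨⟨circulant f, aeval (circulant (Pi.single (1 : Fin ℓ) (1 : F))) u,
    mul_eq_one_comm.1 key, key⟩, rfl⟩

/-- The literal `gcd(f, x^ℓ − 1) = 1` form (Euclidean `gcd` in `F[x]`, as in the tree's
`PanteleevKalachev2021_prop1`). Proved.
[cite: WangPryadko2022, §3.1 Statement 3(v) (arXiv:2203.17216 chunk p0006 L131-132)] -/
theorem isUnit_circulant_of_gcd_eq_one [DecidableEq F] (f : Fin ℓ → F)
    (h : EuclideanDomain.gcd (GBDim.vecPoly f) ((X : F[X]) ^ ℓ - 1) = 1) : IsUnit (circulant f) := by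
  refine isUnit_circulant_of_isCoprime f
    ⟨EuclideanDomain.gcdA (GBDim.vecPoly f) ((X : F[X]) ^ ℓ - 1),
      EuclideanDomain.gcdB (GBDim.vecPoly f) ((X : F[X]) ^ ℓ - 1), ?_⟩
  rw [mul_comm (EuclideanDomain.gcdA _ _), mul_comm (EuclideanDomain.gcdB _ _),
    ← EuclideanDomain.gcd_eq_gcd_ab, h]

end Coprime

/-- **Statement 3(v) as printed** (binary GB codes, `ℓ × ℓ` circulants indexed by `ℤ_ℓ = Fin ℓ`):
"`a'(x) = f(x) a(x)`, `b'(x) = f(x) b(x)`, for some polynomial `f(x)` such that `gcd(f, x^ℓ − 1) = 1`"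
yields an equivalent — indeed the SAME — code: identical `[[n,k,d]]` predicate. Here
`f ⋆ a = circulant f *ᵥ a` is the coefficient vector of `f(x)a(x) mod (x^ℓ − 1)` and `gbPoly f = Σ_i f_i xⁱ`.
Proved. [cite: WangPryadko2022, §3.1 Statement 3(v) (arXiv:2203.17216 chunk p0006 L115-132)] -/
theorem css_conv_isCode_iff_of_gcd_eq_one {ℓ : ℕ} [NeZero ℓ] (f a b : Fin ℓ → ZMod 2)
    (hf : EuclideanDomain.gcd (gbPoly f) ((X : (ZMod 2)[X]) ^ ℓ - 1) = 1) (n k d : ℕ) :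
    (css (circulant f *ᵥ a) (circulant f *ᵥ b)).IsCode n k d ↔ (css a b).IsCode n k d :=
  css_conv_isCode_iff (isUnit_circulant_of_gcd_eq_one f hf) a b n k d

/-- The `IsCoprime` spelling of the same. Proved.
[cite: WangPryadko2022, §3.1 Statement 3(v) (arXiv:2203.17216 chunk p0006 L115-132)] -/
theorem css_conv_isCode_iff_of_isCoprime {ℓ : ℕ} [NeZero ℓ] (f a b : Fin ℓ → ZMod 2)
    (hf : IsCoprime (gbPoly f) ((X : (ZMod 2)[X]) ^ ℓ - 1)) (n k d : ℕ) :
    (css (circulant f *ᵥ a) (circulant f *ᵥ b)).IsCode n k d ↔ (css a b).IsCode n k d :=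
  css_conv_isCode_iff (isUnit_circulant_of_isCoprime f hf) a b n k d

end AbelianTwoBlock

end PrintedHypothesis

end Literature.InformationTheory.QuantumCodes
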